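import Literature.Analysis.Convex.QuasiconvexMaximumPrinciple
import HarnessLib

/-!
# The multi-convexity vertex principle on a box and the vertex test for quadratic parameterized LMIs

Topic `Literature/Analysis/Convex`. Source: P. Apkarian, H. D. Tuan, *Parameterized LMIs in control
theory*, SIAM J. Control Optim. **38** (2000), no. 4, 1241–1264 [ApkarianTuan2000] (held text
`paper:doi-10-1137-s036301299732612x`, author version, 20 pp.; read: §2–§4.3, pp. 2–8), §3 «Extreme
point results» and §4.1 «Relaxation of PLMIs».

## The printed statements

§3, Corollary 3.2 (Multi-quasi-convexity), verbatim: *"Consider a polytope `Π` and the directions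
`d₁, …, d_q` determined by the edges of `Π`. Assume that for any `x` in `Π`, the function `f` is
quasi-convex on the line segments `L_{dᵢ}(x)` for `i = 1, …, q`. Then, `f` has a maximum over `Π` at
a vertex of `Π`."* Corollary 3.3: *"Under the hypotheses of Corollary 3.2, the following conditions
are equivalent: (i) `f(x) < 0, ∀ x ∈ Π`; (ii) `f(x) < 0, ∀ x ∈ vert Π`."* Then: *"Alternative
conditions that are more easily amenable to numerical computation are derived by replacing
quasi-convexity with convexity in Theorem 3.1, Corollaries 3.2 and 3.3. For twice continuously
differentiable functions, Corollary 3.2 then becomes. Corollary 3.4 (Multi-convexity). With the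
definitions in Corollary 3.2, `f` has a maximum over `Π` in `vert Π` whenever it holds that
`∂²f(x + λdᵢ)/∂λ² ≥ 0, ∀ x ∈ Π, i = 1, …, q` (4)."* Corollary 3.5 (Quadratic functions): *"Consider
a quadratic function `f(x) = xᵀQx + cᵀx + a`, and assume `Π` is a hyper-rectangle with edges
paralleling the axes of coordinates, that is, `x = [x₁, …, xₙ]ᵀ` with `αᵢ ≤ xᵢ ≤ βᵢ`, `i = 1, …, n`.
Assume further that `Qᵢᵢ ≥ 0, i = 1, …, n` (5), then `f` has a maximum over `Π` in `vert Π`. Proof.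
From Corollary 3.4, the conditions (5) express multi-convexity of the quadratic function. Clearly,
the conditions (5) are less demanding than (global) convexity which requires `Q ≥ 0`."*

§4.1, display after (14) (the hyper-rectangle case, *"the main result in [18] is recovered as a
special case"*, [18] = Gahinet–Apkarian–Chilali, IEEE TAC 41 (1996)): *"Assume `θ := [θ₁, …, θ_N]ᵀ`
ranges over a hyper-rectangle, denoted `H`, that is, `θ̲ᵢ ≤ θᵢ ≤ θ̄ᵢ` (14), then
`L(z, θ) := M₀(z) + Σᵢ θᵢ Mᵢ(z) + Σᵢⱼ θᵢθⱼ Mᵢⱼ(z) < 0, ∀ θ ∈ H` whenever `L(z, θ) < 0, θ ∈ vert H`;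
`Mᵢᵢ(z) ≥ 0, i = 1, …, N`. As before, one can relax the multi-convexity requirement above by
replacing these conditions with `L(z, θ) < −Σᵢ θᵢ² λᵢ I, θ ∈ vert H` (15);
`Mᵢᵢ(z) ≥ −λᵢ I, i = 1, …, N` (16). More generally, any non-positive matrix-valued function of `θ`
is a good candidate for the right-hand side of (15)."* (The proof, given for Proposition 4.1: *"the
conditions (7) are equivalent to `xᵀL(z, θ)x < 0`, for all `x ≠ 0`. For fixed `x ≠ 0`, consider
`xᵀL(z, θ)x` as function of `θ`. By virtue of Corollary 3.4, it is negative whenever it is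
multi-convex along lines paralleling the edges … and furthermore is negative over `vert`"*.)

## What is formalised (all proved; Mathlib vocabulary; no facts, no axioms)

The BOX (hyper-rectangle) case, which is the one used in §4.1 and in [18]: the box is
`Set.Icc lo hi ⊆ ι → ℝ` (product order, `ι` a finite index type), its vertices are the points with
every coordinate at an endpoint (`IsVertex`), the edge directions are the coordinate directions, and
"`f` is (quasi-)convex on the segments `L_{dᵢ}(x)`" is (quasi-)convexity of every coordinate SECTION
`t ↦ f (update x i t)` on the edge interval `[lo i, hi i]` (`MultiquasiconvexOn` / `MulticonvexOn`;
Mathlib's `QuasiconvexOn` / `ConvexOn`).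
* §1 **Vertex principle** (Cor. 3.2/3.4, box case): `MultiquasiconvexOn.exists_vertex_ge` (every box
  point is dominated by a vertex), `MultiquasiconvexOn.exists_isVertex_isMaxOn` (the maximum over a
  nonempty box is attained at a vertex), the sign tests `MultiquasiconvexOn.le_of_forall_vertex`,
  `MultiquasiconvexOn.lt_of_forall_vertex` and Cor. 3.3
  `MultiquasiconvexOn.forall_lt_iff_forall_vertex`; the convex versions
  `MulticonvexOn.multiquasiconvexOn`, `MulticonvexOn.exists_vertex_ge`,
  `MulticonvexOn.forall_lt_iff_forall_vertex`, and the printed second-derivative criterion (4)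
  `multiconvexOn_of_deriv2_nonneg` (via Mathlib's `convexOn_of_deriv2_nonneg` on each section). The
  proof is the paper's edge-pushing argument made explicit: by quasiconvexity of the section through
  `x` along coordinate `a`, `f x ≤ max (f (x with xₐ := lo a)) (f (x with xₐ := hi a))` (the tree's
  `QuasiconvexOn.le_max_of_mem_segment`, `QuasiconvexMaximumPrinciple.lean`), and an induction on
  the set of coordinates not yet at an endpoint.
* §2 **Quadratic functions** (Cor. 3.5): `multiconvexOn_quadratic` — `x ↦ xᵀQx + cᵀx + a` with
  `Qᵢᵢ ≥ 0` is multi-convex on every box (the section along `i` is a parabola with leading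
  coefficient `Qᵢᵢ`, `quadratic_section`), hence `exists_vertex_ge_quadratic` and the sign test
  `quadratic_forall_lt_iff_forall_vertex`; and the remark that (5) is weaker than convexity:
  `multiconvexOn_mul_fin_two` / `not_convexOn_mul_fin_two` (`x₁x₂` is multi-convex, not convex).
* §3 **Quadratic PLMIs on a hyper-rectangle** (§4.1 after (14); [18]): for the family
  `quadFamily M₀ M₁ M₂ θ = M₀ + Σᵢ θᵢ•M₁ i + Σᵢⱼ (θᵢθⱼ)•M₂ i j` of real `n × n` matrices the form
  `yᵀL(θ)y` is the quadratic function of `θ` with `Q i j = yᵀM₂ i j y`, `c i = yᵀM₁ i y`,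
  `a = yᵀM₀y` (`form_quadFamily`), so `M₂ i i ⪰ 0` (as forms) makes it multi-convex
  (`multiconvexOn_form_quadFamily`) and NEGATIVITY OF THE FORM AT THE `2^N` VERTICES GIVES
  NEGATIVITY ON THE BOX (`form_neg_on_box_of_forall_vertex`; `Matrix.PosDef` packaging for symmetric
  data `posDef_neg_on_box_of_forall_vertex`), together with the RELAXED test (15)–(16) with
  multipliers `λᵢ ≥ 0` (`form_neg_on_box_of_forall_vertex_relaxed`; the sign `λᵢ ≥ 0`, implicit in
  the paper's "any non-positive matrix-valued function of `θ` is a good candidate for the right-hand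
  side of (15)", is an explicit hypothesis here).

## What is NOT formalised

Theorem 3.1 itself (general polytope: a maximum on the RELATIVE BOUNDARY under quasi-convexity along
one direction of the affine hull) and Cor. 3.2 for general polytopes (edge directions of an
arbitrary polytope); Proposition 4.1 (the SIMPLEX / polytopic-coordinates test with edge directions
`eᵢ − eⱼ`); Lemma 4.2 (polynomial parameter dependence of higher degree); §4.2–§5 (gridding,
algebraically constrained PLMIs, Lyapunov / `H₂` / LPV applications) and every statement about LMI
solvers. The jointly (quasi)convex maximum principle over polytopes is the tree's
`QuasiconvexMaximumPrinciple.lean` (Cambini–Martein Thm 4.6.3); the present SEPARATE convexity is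
strictly weaker (`not_convexOn_mul_fin_two`). The AFFINE special case (`M₂ = 0`) of §3 is the tree's
`ParametricVertexCertificate.lean` / `AffineCornerTest.lean`
(Literature/Analysis/ValidatedNumerics), not restated.

## References

* [ApkarianTuan2000] P. Apkarian, H. D. Tuan, Parameterized LMIs in control theory, SIAM J. Control
  Optim. 38 (2000) 1241–1264, §3 Thm. 3.1, Cor. 3.2–3.5, §4.1 Prop. 4.1 and (14)–(16).
  [cite: ApkarianTuan2000, §3 Cor. 3.2–3.5; §4.1 (14)–(16)]
* [GahinetApkarianChilali1996] P. Gahinet, P. Apkarian, M. Chilali, Affine parameter-dependent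
  Lyapunov functions and real parametric uncertainty, IEEE Trans. Automat. Control 41 (1996) 436–442
  — reference [18] of the source, whose box vertex test §4.1 recovers.
  [cite: GahinetApkarianChilali1996, §III]
-/

open Set Function Finset Matrix

namespace Literature.Analysis.Convex.MulticonvexVertexPrinciple

variable {ι : Type*}

/-! ### §0 Boxes `Set.Icc lo hi ⊆ ι → ℝ` and their vertices -/

/-- `v` is a VERTEX of the box `[lo, hi]`: every coordinate sits at an endpoint (`vert H` of
[ApkarianTuan2000, §2, §4.1 (14)]). [cite: ApkarianTuan2000, §2 and §4.1 (14)] -/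
def IsVertex (lo hi v : ι → ℝ) : Prop :=
  ∀ i, v i = lo i ∨ v i = hi i

/-- The lower corner is a vertex. [cite: ApkarianTuan2000, §2 (vert Π)] -/
theorem isVertex_lo (lo hi : ι → ℝ) : IsVertex lo hi lo := fun _ => Or.inl rfl

/-- The upper corner is a vertex. [cite: ApkarianTuan2000, §2 (vert Π)] -/
theorem isVertex_hi (lo hi : ι → ℝ) : IsVertex lo hi hi := fun _ => Or.inr rfl

/-- A vertex of a nonempty box lies in the box. [cite: ApkarianTuan2000, §2 (vert Π ⊆ Π)] -/
theorem IsVertex.mem_Icc {lo hi v : ι → ℝ} (hv : IsVertex lo hi v) (h : lo ≤ hi) :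
    v ∈ Icc lo hi := by
  refine ⟨fun i => ?_, fun i => ?_⟩ <;> rcases hv i with hi' | hi' <;> rw [hi']
  · exact h i
  · exact h i

/-- A box has finitely many vertices (at most `2^|ι|`).
[cite: ApkarianTuan2000, §2 (vert Π = V finite)] -/
theorem finite_setOf_isVertex [Finite ι] (lo hi : ι → ℝ) : {v : ι → ℝ | IsVertex lo hi v}.Finite :=
  (Set.Finite.pi fun i => Set.toFinite ({lo i, hi i} : Set ℝ)).subset fun v hv =>
    Set.mem_univ_pi.2 fun i => by
      rcases hv i with h | h
      · exact Or.inl h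
      · exact Or.inr h

/-! ### §1 Separate (quasi-)convexity along the edges and the vertex principle (Cor. 3.2–3.4) -/

/-- `f` is MULTI-QUASI-CONVEX on the box `[lo, hi]` [ApkarianTuan2000, Cor. 3.2]: through every
point of the box the section of `f` along every coordinate (edge) direction is quasiconvex on the
edge interval. [cite: ApkarianTuan2000, §3 Cor. 3.2] -/
def MultiquasiconvexOn [DecidableEq ι] (lo hi : ι → ℝ) (f : (ι → ℝ) → ℝ) : Prop :=
  ∀ x ∈ Icc lo hi, ∀ i, QuasiconvexOn ℝ (Icc (lo i) (hi i)) fun t => f (update x i t)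

/-- `f` is MULTI-CONVEX on the box `[lo, hi]` [ApkarianTuan2000, Cor. 3.4]: every coordinate section
through every box point is convex on the edge interval. [cite: ApkarianTuan2000, §3 Cor. 3.4] -/
def MulticonvexOn [DecidableEq ι] (lo hi : ι → ℝ) (f : (ι → ℝ) → ℝ) : Prop :=
  ∀ x ∈ Icc lo hi, ∀ i, ConvexOn ℝ (Icc (lo i) (hi i)) fun t => f (update x i t)

section Principle

variable [DecidableEq ι] {lo hi : ι → ℝ} {f : (ι → ℝ) → ℝ}

/-- *"replacing quasi-convexity with convexity"*: multi-convex implies multi-quasi-convex.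
[cite: ApkarianTuan2000, §3 before Cor. 3.4] -/
theorem MulticonvexOn.multiquasiconvexOn (hf : MulticonvexOn lo hi f) :
    MultiquasiconvexOn lo hi f :=
  fun x hx i => (hf x hx i).quasiconvexOn

/-- Moving one coordinate of a box point inside its edge interval stays in the box. [folklore] -/
private theorem update_mem_Icc {x : ι → ℝ} (hx : x ∈ Icc lo hi) (a : ι) {t : ℝ}
    (ht : t ∈ Icc (lo a) (hi a)) : update x a t ∈ Icc lo hi := by
  refine ⟨fun i => ?_, fun i => ?_⟩ <;> by_cases h : i = a
  · rw [h, update_self]; exact ht.1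
  · rw [update_of_ne h]; exact hx.1 i
  · rw [h, update_self]; exact ht.2
  · rw [update_of_ne h]; exact hx.2 i

/-- The one-edge step of the vertex principle: by quasiconvexity of the section along `a`, the value
at `x` is dominated by the value at one of the two points with `xₐ` pushed to an endpoint.
[folklore] -/
private theorem le_max_update (hf : MultiquasiconvexOn lo hi f) {x : ι → ℝ} (hx : x ∈ Icc lo hi)
    (a : ι) : f x ≤ max (f (update x a (lo a))) (f (update x a (hi a))) := by
  have hlo : lo a ≤ hi a := (hx.1 a).trans (hx.2 a)
  have hseg : x a ∈ segment ℝ (lo a) (hi a) := by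
    rw [segment_eq_Icc hlo]; exact ⟨hx.1 a, hx.2 a⟩
  have h := QuasiconvexOn.le_max_of_mem_segment (hf x hx a) (left_mem_Icc.2 hlo)
    (right_mem_Icc.2 hlo)
    hseg
  simpa only [update_eq_self] using h

/-- Induction on the set `s` of coordinates not yet at an endpoint. [folklore] -/
private theorem exists_vertex_ge_aux (hf : MultiquasiconvexOn lo hi f) (s : Finset ι) :
    ∀ x ∈ Icc lo hi, (∀ i, i ∉ s → (x i = lo i ∨ x i = hi i)) →
      ∃ v ∈ Icc lo hi, IsVertex lo hi v ∧ f x ≤ f v := by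
  induction s using Finset.induction_on with
  | empty => exact fun x hx hv => ⟨x, hx, fun i => hv i (Finset.notMem_empty i), le_rfl⟩
  | insert a s ha ih =>
    intro x hx hv
    have hlo : lo a ≤ hi a := (hx.1 a).trans (hx.2 a)
    have hfree : ∀ t : ℝ, (t = lo a ∨ t = hi a) →
        ∀ i, i ∉ s → (update x a t i = lo i ∨ update x a t i = hi i) := by
      intro t ht i hi
      by_cases h : i = a
      · rw [h, update_self]; exact ht
      · rw [update_of_ne h]
        exact hv i (by simp [h, hi])
    rcases le_max_iff.1 (le_max_update hf hx a) with h | h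
    · obtain ⟨v, hv1, hv2, hv3⟩ :=
        ih (update x a (lo a)) (update_mem_Icc hx a (left_mem_Icc.2 hlo)) (hfree _ (Or.inl rfl))
      exact ⟨v, hv1, hv2, h.trans hv3⟩
    · obtain ⟨v, hv1, hv2, hv3⟩ :=
        ih (update x a (hi a)) (update_mem_Icc hx a (right_mem_Icc.2 hlo)) (hfree _ (Or.inr rfl))
      exact ⟨v, hv1, hv2, h.trans hv3⟩

/-- **Vertex principle, domination form** (box case of [ApkarianTuan2000, Cor. 3.2]): on a box,
every point of a multi-quasi-convex function is dominated by some VERTEX of the box.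
[cite: ApkarianTuan2000, §3 Cor. 3.2] -/
theorem MultiquasiconvexOn.exists_vertex_ge [Fintype ι] (hf : MultiquasiconvexOn lo hi f)
    {x : ι → ℝ} (hx : x ∈ Icc lo hi) : ∃ v ∈ Icc lo hi, IsVertex lo hi v ∧ f x ≤ f v :=
  exists_vertex_ge_aux hf Finset.univ x hx fun i hi => (hi (Finset.mem_univ i)).elim

/-- **Vertex principle, attained form** ([ApkarianTuan2000, Cor. 3.2]: *"f has a maximum over `Π` at
a vertex of `Π`"*, box case): a multi-quasi-convex function on a nonempty box attains its maximum
over the box at a vertex. [cite: ApkarianTuan2000, §3 Cor. 3.2] -/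
theorem MultiquasiconvexOn.exists_isVertex_isMaxOn [Fintype ι] (hf : MultiquasiconvexOn lo hi f)
    (h : lo ≤ hi) : ∃ v ∈ Icc lo hi, IsVertex lo hi v ∧ IsMaxOn f (Icc lo hi) v := by
  obtain ⟨v, hv, hmax⟩ := Set.exists_max_image {v : ι → ℝ | IsVertex lo hi v} f
    (finite_setOf_isVertex lo hi) ⟨lo, isVertex_lo lo hi⟩
  refine ⟨v, IsVertex.mem_Icc hv h, hv, isMaxOn_iff.2 fun x hx => ?_⟩
  obtain ⟨w, -, hw, hxw⟩ := hf.exists_vertex_ge hx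
  exact hxw.trans (hmax w hw)

/-- **Sign test, `≤` form**: an upper bound valid at the vertices is valid on the whole box.
[cite: ApkarianTuan2000, §3 Cor. 3.3] -/
theorem MultiquasiconvexOn.le_of_forall_vertex [Fintype ι] (hf : MultiquasiconvexOn lo hi f) {c : ℝ}
    (hc : ∀ v, IsVertex lo hi v → f v ≤ c) {x : ι → ℝ} (hx : x ∈ Icc lo hi) : f x ≤ c := by
  obtain ⟨v, -, hv, hxv⟩ := hf.exists_vertex_ge hx
  exact hxv.trans (hc v hv)

/-- **Sign test, strict form** ([ApkarianTuan2000, Cor. 3.3] (ii) ⇒ (i)): a strict upper bound valid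
at the vertices is valid on the whole box. [cite: ApkarianTuan2000, §3 Cor. 3.3] -/
theorem MultiquasiconvexOn.lt_of_forall_vertex [Fintype ι] (hf : MultiquasiconvexOn lo hi f) {c : ℝ}
    (hc : ∀ v, IsVertex lo hi v → f v < c) {x : ι → ℝ} (hx : x ∈ Icc lo hi) : f x < c := by
  obtain ⟨v, -, hv, hxv⟩ := hf.exists_vertex_ge hx
  exact hxv.trans_lt (hc v hv)

/-- **Corollary 3.3** (box case): for a multi-quasi-convex `f` on a nonempty box, `f < c` on the box
iff `f < c` at the vertices (the paper has `c = 0`). [cite: ApkarianTuan2000, §3 Cor. 3.3] -/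
theorem MultiquasiconvexOn.forall_lt_iff_forall_vertex [Fintype ι] (hf : MultiquasiconvexOn lo hi f)
    (h : lo ≤ hi) (c : ℝ) :
    (∀ x ∈ Icc lo hi, f x < c) ↔ ∀ v, IsVertex lo hi v → f v < c :=
  ⟨fun H v hv => H v (hv.mem_Icc h), fun H _ hx => hf.lt_of_forall_vertex H hx⟩

/-- **Corollary 3.4, domination form**: on a box, every point of a multi-convex function is
dominated by a vertex. [cite: ApkarianTuan2000, §3 Cor. 3.4] -/
theorem MulticonvexOn.exists_vertex_ge [Fintype ι] (hf : MulticonvexOn lo hi f) {x : ι → ℝ}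
    (hx : x ∈ Icc lo hi) : ∃ v ∈ Icc lo hi, IsVertex lo hi v ∧ f x ≤ f v :=
  hf.multiquasiconvexOn.exists_vertex_ge hx

/-- **Corollary 3.4, attained form**: a multi-convex function on a nonempty box attains its maximum
at a vertex. [cite: ApkarianTuan2000, §3 Cor. 3.4] -/
theorem MulticonvexOn.exists_isVertex_isMaxOn [Fintype ι] (hf : MulticonvexOn lo hi f)
    (h : lo ≤ hi) :
    ∃ v ∈ Icc lo hi, IsVertex lo hi v ∧ IsMaxOn f (Icc lo hi) v :=
  hf.multiquasiconvexOn.exists_isVertex_isMaxOn h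

/-- **Corollary 3.4, sign test (`≤`)**: for a multi-convex `f`, an upper bound valid at the vertices
is valid on the whole box. [cite: ApkarianTuan2000, §3 Cor. 3.3–3.4] -/
theorem MulticonvexOn.le_of_forall_vertex [Fintype ι] (hf : MulticonvexOn lo hi f) {c : ℝ}
    (hc : ∀ v, IsVertex lo hi v → f v ≤ c) {x : ι → ℝ} (hx : x ∈ Icc lo hi) : f x ≤ c :=
  hf.multiquasiconvexOn.le_of_forall_vertex hc hx

/-- **Corollary 3.4, sign test (`<`)**: for a multi-convex `f`, a strict upper bound valid at the
vertices is valid on the whole box. [cite: ApkarianTuan2000, §3 Cor. 3.3–3.4] -/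
theorem MulticonvexOn.lt_of_forall_vertex [Fintype ι] (hf : MulticonvexOn lo hi f) {c : ℝ}
    (hc : ∀ v, IsVertex lo hi v → f v < c) {x : ι → ℝ} (hx : x ∈ Icc lo hi) : f x < c :=
  hf.multiquasiconvexOn.lt_of_forall_vertex hc hx

/-- **Corollaries 3.3/3.4, sign test**: for a multi-convex `f` on a nonempty box, `f < c` on the box
iff `f < c` at the vertices. [cite: ApkarianTuan2000, §3 Cor. 3.3–3.4] -/
theorem MulticonvexOn.forall_lt_iff_forall_vertex [Fintype ι] (hf : MulticonvexOn lo hi f)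
    (h : lo ≤ hi) (c : ℝ) :
    (∀ x ∈ Icc lo hi, f x < c) ↔ ∀ v, IsVertex lo hi v → f v < c :=
  hf.multiquasiconvexOn.forall_lt_iff_forall_vertex h c

/-- **Corollary 3.4 as printed** (the second-derivative criterion (4),
`∂²f(x + λdᵢ)/∂λ² ≥ 0 ∀ x ∈ Π`): if every coordinate section through every box point is continuous
on the edge interval, twice differentiable inside it, with nonnegative second derivative, then `f`
is multi-convex on the box (Mathlib's `convexOn_of_deriv2_nonneg`, section by section).
[cite: ApkarianTuan2000, §3 Cor. 3.4 (4)] -/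
theorem multiconvexOn_of_deriv2_nonneg
    (hcont : ∀ x ∈ Icc lo hi, ∀ i, ContinuousOn (fun t => f (update x i t)) (Icc (lo i) (hi i)))
    (hdiff : ∀ x ∈ Icc lo hi, ∀ i,
      DifferentiableOn ℝ (fun t => f (update x i t)) (Ioo (lo i) (hi i)))
    (hdiff₂ : ∀ x ∈ Icc lo hi, ∀ i,
      DifferentiableOn ℝ (deriv fun t => f (update x i t)) (Ioo (lo i) (hi i)))
    (hnonneg : ∀ x ∈ Icc lo hi, ∀ i, ∀ t ∈ Ioo (lo i) (hi i),
      0 ≤ deriv^[2] (fun t => f (update x i t)) t) :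
    MulticonvexOn lo hi f := by
  intro x hx i
  refine convexOn_of_deriv2_nonneg (convex_Icc (lo i) (hi i)) (hcont x hx i) ?_ ?_ ?_
  · rw [interior_Icc]; exact hdiff x hx i
  · rw [interior_Icc]; exact hdiff₂ x hx i
  · rw [interior_Icc]; exact hnonneg x hx i

end Principle

/-! ### §2 Quadratic functions on a hyper-rectangle (Cor. 3.5) -/

section Quadratic

variable [DecidableEq ι]

/-- A parabola `t ↦ p + q (t − t₀) + r (t − t₀)²` with `r ≥ 0` is convex. [folklore] -/
private theorem convexOn_parabola {r : ℝ} (hr : 0 ≤ r) (p q t₀ : ℝ) :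
    ConvexOn ℝ univ fun t : ℝ => p + q * (t - t₀) + r * (t - t₀) ^ 2 := by
  refine ⟨convex_univ, ?_⟩
  intro x _ y _ a b ha hb hab
  simp only [smul_eq_mul]
  have hb' : b = 1 - a := by linarith
  subst hb'
  have key : a * (p + q * (x - t₀) + r * (x - t₀) ^ 2)
      + (1 - a) * (p + q * (y - t₀) + r * (y - t₀) ^ 2)
      - (p + q * (a * x + (1 - a) * y - t₀) + r * (a * x + (1 - a) * y - t₀) ^ 2)
        = r * (a * (1 - a) * (x - y) ^ 2) := by
    ring
  nlinarith [mul_nonneg hr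
    (mul_nonneg (mul_nonneg ha (by linarith : (0 : ℝ) ≤ 1 - a)) (sq_nonneg (x - y)))]

/-- Moving along coordinate `i`: `update x i t = x + (t − xᵢ) eᵢ`. [folklore] -/
private theorem update_eq_add_smul_single (x : ι → ℝ) (i : ι) (t : ℝ) :
    update x i t = x + (t - x i) • Pi.single i (1 : ℝ) := by
  ext j
  by_cases h : j = i
  · subst h; simp
  · simp [h]

variable [Fintype ι]

/-- `eᵢᵀQeᵢ = Qᵢᵢ`. [folklore] -/
private theorem single_dotProduct_mulVec_single (Q : Matrix ι ι ℝ) (i : ι) :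
    Pi.single i (1 : ℝ) ⬝ᵥ (Q *ᵥ Pi.single i 1) = Q i i := by
  simp [single_dotProduct]

/-- **The coordinate section of a quadratic function is a parabola with leading coefficient `Qᵢᵢ`**
(the computation behind *"the conditions (5) express multi-convexity of the quadratic function"*).
[cite: ApkarianTuan2000, §3 Cor. 3.5 (proof)] -/
theorem quadratic_section (Q : Matrix ι ι ℝ) (c : ι → ℝ) (a : ℝ) (x : ι → ℝ) (i : ι) (t : ℝ) :
    update x i t ⬝ᵥ (Q *ᵥ update x i t) + c ⬝ᵥ update x i t + a
      = (x ⬝ᵥ (Q *ᵥ x) + c ⬝ᵥ x + a)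
        + (Pi.single i (1 : ℝ) ⬝ᵥ (Q *ᵥ x) + x ⬝ᵥ (Q *ᵥ Pi.single i 1) + c ⬝ᵥ Pi.single i 1)
            * (t - x i)
        + Q i i * (t - x i) ^ 2 := by
  rw [update_eq_add_smul_single, ← single_dotProduct_mulVec_single Q i]
  simp only [mulVec_add, mulVec_smul, add_dotProduct, dotProduct_add, smul_dotProduct,
    dotProduct_smul,
    smul_eq_mul]
  ring

/-- **Corollary 3.5** (Quadratic functions): `f(x) = xᵀQx + cᵀx + a` with `Qᵢᵢ ≥ 0` for all `i` (5)
is multi-convex on every hyper-rectangle `[lo, hi]`. [cite: ApkarianTuan2000, §3 Cor. 3.5] -/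
theorem multiconvexOn_quadratic (Q : Matrix ι ι ℝ) (c : ι → ℝ) (a : ℝ) (hQ : ∀ i, 0 ≤ Q i i)
    (lo hi : ι → ℝ) : MulticonvexOn lo hi fun x => x ⬝ᵥ (Q *ᵥ x) + c ⬝ᵥ x + a := by
  intro x _ i
  refine ((convexOn_parabola (hQ i) (x ⬝ᵥ (Q *ᵥ x) + c ⬝ᵥ x + a)
    (Pi.single i (1 : ℝ) ⬝ᵥ (Q *ᵥ x) + x ⬝ᵥ (Q *ᵥ Pi.single i 1) + c ⬝ᵥ Pi.single i 1) (x i)).subset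
    (subset_univ _) (convex_Icc _ _)).congr fun t _ => ?_
  exact (quadratic_section Q c a x i t).symm

/-- **Corollary 3.5, conclusion**: a quadratic function with `Qᵢᵢ ≥ 0` is dominated on the box by
its value at some vertex (*"f has a maximum over `Π` in `vert Π`"*).
[cite: ApkarianTuan2000, §3 Cor. 3.5] -/
theorem exists_vertex_ge_quadratic (Q : Matrix ι ι ℝ) (c : ι → ℝ) (a : ℝ) (hQ : ∀ i, 0 ≤ Q i i)
    {lo hi x : ι → ℝ} (hx : x ∈ Icc lo hi) :
    ∃ v ∈ Icc lo hi, IsVertex lo hi v ∧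
      x ⬝ᵥ (Q *ᵥ x) + c ⬝ᵥ x + a ≤ v ⬝ᵥ (Q *ᵥ v) + c ⬝ᵥ v + a :=
  (multiconvexOn_quadratic Q c a hQ lo hi).exists_vertex_ge hx

/-- **Corollary 3.5 with Corollary 3.3**: for a quadratic function with `Qᵢᵢ ≥ 0` on a nonempty box,
`f < b` on the box iff `f < b` at the `2ⁿ` vertices (a boolean problem, *"the maximization of f over
the polytope reduces to a boolean programming problem"*).
[cite: ApkarianTuan2000, §3 Cor. 3.5 and Cor. 3.3] -/
theorem quadratic_forall_lt_iff_forall_vertex (Q : Matrix ι ι ℝ) (c : ι → ℝ) (a : ℝ)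
    (hQ : ∀ i, 0 ≤ Q i i) {lo hi : ι → ℝ} (h : lo ≤ hi) (b : ℝ) :
    (∀ x ∈ Icc lo hi, x ⬝ᵥ (Q *ᵥ x) + c ⬝ᵥ x + a < b) ↔
      ∀ v, IsVertex lo hi v → v ⬝ᵥ (Q *ᵥ v) + c ⬝ᵥ v + a < b :=
  (multiconvexOn_quadratic Q c a hQ lo hi).forall_lt_iff_forall_vertex h b

end Quadratic

/-! ### §2b Multi-convexity is weaker than convexity: `x₁x₂` -/

/-- *"Clearly, the conditions (5) are less demanding than (global) convexity which requires
`Q ≥ 0`"*: the bilinear function `x₁x₂` on `ℝ²` is multi-convex on every box (its sections are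
affine) … [cite: ApkarianTuan2000, §3 after Cor. 3.5] -/
theorem multiconvexOn_mul_fin_two (lo hi : Fin 2 → ℝ) :
    MulticonvexOn lo hi fun x : Fin 2 → ℝ => x 0 * x 1 := by
  intro x _ i
  refine ⟨convex_Icc _ _, fun s _ t _ a b _ _ hab => le_of_eq ?_⟩
  fin_cases i <;> simp only [smul_eq_mul, Fin.zero_eta, Fin.mk_one, Fin.isValue, update_self, ne_eq,
    zero_ne_one, not_false_eq_true, update_of_ne, one_ne_zero]
  · ring
  · ring

/-- … but it is NOT convex: `f(1, −1) = f(−1, 1) = −1` while the midpoint value is `f(0, 0) = 0`.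
[cite: ApkarianTuan2000, §3 after Cor. 3.5] -/
theorem not_convexOn_mul_fin_two : ¬ ConvexOn ℝ univ fun x : Fin 2 → ℝ => x 0 * x 1 := by
  intro h
  have h1 := h.2 (mem_univ ![(1 : ℝ), -1]) (mem_univ ![(-1 : ℝ), 1])
    (show (0 : ℝ) ≤ 1 / 2 by norm_num) (show (0 : ℝ) ≤ 1 / 2 by norm_num)
    (show (1 / 2 : ℝ) + 1 / 2 = 1 by norm_num)
  norm_num [Pi.add_apply, Pi.smul_apply] at h1

/-! ### §3 Quadratic parameterized LMIs on a hyper-rectangle (§4.1 after (14); [18]) -/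

section PLMI

variable {κ : Type*} [Fintype κ] {n : Type*} [Fintype n]

/-- The quadratically parameter-dependent matrix family `L(θ) = M₀ + Σᵢ θᵢ Mᵢ + Σᵢⱼ θᵢθⱼ Mᵢⱼ` of
[ApkarianTuan2000, §4.1 after (14)] (real `n × n` data; the decision variable `z` of the paper is
fixed and suppressed). [cite: ApkarianTuan2000, §4.1 (14)] -/
def quadFamily (M₀ : Matrix n n ℝ) (M₁ : κ → Matrix n n ℝ) (M₂ : κ → κ → Matrix n n ℝ)
    (θ : κ → ℝ) : Matrix n n ℝ :=
  M₀ + ∑ i, θ i • M₁ i + ∑ i, ∑ j, (θ i * θ j) • M₂ i j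

variable (M₀ : Matrix n n ℝ) (M₁ : κ → Matrix n n ℝ) (M₂ : κ → κ → Matrix n n ℝ)

/-- `θᵀ(of F)θ = Σᵢⱼ θᵢθⱼ Fᵢⱼ`. [folklore] -/
private theorem dotProduct_of_mulVec (F : κ → κ → ℝ) (θ : κ → ℝ) :
    θ ⬝ᵥ (Matrix.of F *ᵥ θ) = ∑ i, ∑ j, θ i * θ j * F i j := by
  simp only [dotProduct, mulVec, Matrix.of_apply, Finset.mul_sum]
  refine Finset.sum_congr rfl fun i _ => Finset.sum_congr rfl fun j _ => ?_
  ring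

/-- **The form of the family is a quadratic function of the parameter**: for fixed `y`,
`yᵀL(θ)y = θᵀQθ + cᵀθ + a` with `Qᵢⱼ = yᵀMᵢⱼy`, `cᵢ = yᵀMᵢy`, `a = yᵀM₀y` (*"For fixed `x ≠ 0`,
consider `xᵀL(z, θ)x` as function of `θ`"*). [cite: ApkarianTuan2000, §4.1 proof of Prop. 4.1] -/
theorem form_quadFamily (θ : κ → ℝ) (y : n → ℝ) :
    y ⬝ᵥ (quadFamily M₀ M₁ M₂ θ *ᵥ y)
      = θ ⬝ᵥ (Matrix.of (fun i j => y ⬝ᵥ (M₂ i j *ᵥ y)) *ᵥ θ)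
        + (fun i => y ⬝ᵥ (M₁ i *ᵥ y)) ⬝ᵥ θ + y ⬝ᵥ (M₀ *ᵥ y) := by
  have h1 : (fun i => y ⬝ᵥ (M₁ i *ᵥ y)) ⬝ᵥ θ = ∑ i, θ i * (y ⬝ᵥ (M₁ i *ᵥ y)) := by
    simp [dotProduct, mul_comm]
  rw [h1, dotProduct_of_mulVec]
  simp only [quadFamily, add_mulVec, dotProduct_add, Matrix.sum_mulVec, dotProduct_sum,
    Matrix.smul_mulVec,
    dotProduct_smul, smul_eq_mul]
  ring

/-- **Multi-convexity of the form** (*"By virtue of Corollary 3.4, it is negative whenever it is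
multi-convex …"*): if the diagonal blocks `Mᵢᵢ` have nonnegative forms (`Mᵢᵢ ≥ 0`), then for every
`y` the function `θ ↦ yᵀL(θ)y` is multi-convex on every hyper-rectangle.
[cite: ApkarianTuan2000, §4.1 after (14)] -/
theorem multiconvexOn_form_quadFamily [DecidableEq κ]
    (hM : ∀ i, ∀ y : n → ℝ, 0 ≤ y ⬝ᵥ (M₂ i i *ᵥ y)) (y : n → ℝ) (lo hi : κ → ℝ) :
    MulticonvexOn lo hi fun θ => y ⬝ᵥ (quadFamily M₀ M₁ M₂ θ *ᵥ y) := by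
  have h := multiconvexOn_quadratic (Matrix.of fun i j => y ⬝ᵥ (M₂ i j *ᵥ y))
    (fun i => y ⬝ᵥ (M₁ i *ᵥ y)) (y ⬝ᵥ (M₀ *ᵥ y)) (fun i => by simpa using hM i y) lo hi
  intro x hx i
  refine (h x hx i).congr fun t _ => ?_
  exact (form_quadFamily M₀ M₁ M₂ (update x i t) y).symm

/-- **The hyper-rectangle vertex test** ([ApkarianTuan2000, §4.1 after (14)], recovering
[GahinetApkarianChilali1996]): if `Mᵢᵢ ≥ 0` for all `i` and the form `yᵀL(θ)y` is negative for
`y ≠ 0` at every VERTEX `θ` of the box, then it is negative for `y ≠ 0` at every `θ` in the box,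
i.e. `L(θ) < 0` on `H`. [cite: ApkarianTuan2000, §4.1 after (14)] -/
theorem form_neg_on_box_of_forall_vertex (hM : ∀ i, ∀ y : n → ℝ, 0 ≤ y ⬝ᵥ (M₂ i i *ᵥ y))
    {lo hi : κ → ℝ}
    (hvert : ∀ v, IsVertex lo hi v → ∀ y : n → ℝ, y ≠ 0 → y ⬝ᵥ (quadFamily M₀ M₁ M₂ v *ᵥ y) < 0)
    {θ : κ → ℝ} (hθ : θ ∈ Icc lo hi) {y : n → ℝ} (hy : y ≠ 0) :
    y ⬝ᵥ (quadFamily M₀ M₁ M₂ θ *ᵥ y) < 0 := by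
  classical
  exact (multiconvexOn_form_quadFamily M₀ M₁ M₂ hM y lo hi).lt_of_forall_vertex
    (fun v hv => hvert v hv y hy) hθ

omit [Fintype n] in
/-- The family is symmetric when its data are. [folklore] -/
private theorem isHermitian_quadFamily (h₀ : M₀.IsHermitian) (h₁ : ∀ i, (M₁ i).IsHermitian)
    (h₂ : ∀ i j, (M₂ i j).IsHermitian) (θ : κ → ℝ) : (quadFamily M₀ M₁ M₂ θ).IsHermitian := by
  unfold quadFamily
  refine (h₀.add (Finset.sum_induction _ _ (fun A B hA hB => hA.add hB) isHermitian_zero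
    fun i _ => ?_)).add (Finset.sum_induction _ _ (fun A B hA hB => hA.add hB) isHermitian_zero
      fun i _ => Finset.sum_induction _ _ (fun A B hA hB => hA.add hB) isHermitian_zero
        fun j _ => ?_)
  · show (θ i • M₁ i)ᴴ = θ i • M₁ i
    rw [conjTranspose_smul, star_trivial, (h₁ i).eq]
  · show ((θ i * θ j) • M₂ i j)ᴴ = (θ i * θ j) • M₂ i j
    rw [conjTranspose_smul, star_trivial, (h₂ i j).eq]

/-- **The hyper-rectangle vertex test, LMI packaging**: with symmetric data, `Mᵢᵢ ⪰ 0` for all `i`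
and `−L(v) ≻ 0` at every vertex `v` of the box imply `−L(θ) ≻ 0` for every `θ` in the box
(`Matrix.PosSemidef` / `Matrix.PosDef`). [cite: ApkarianTuan2000, §4.1 after (14)] -/
theorem posDef_neg_on_box_of_forall_vertex (h₀ : M₀.IsHermitian) (h₁ : ∀ i, (M₁ i).IsHermitian)
    (h₂ : ∀ i j, (M₂ i j).IsHermitian) (hM : ∀ i, (M₂ i i).PosSemidef) {lo hi : κ → ℝ}
    (hvert : ∀ v, IsVertex lo hi v → (-quadFamily M₀ M₁ M₂ v).PosDef) {θ : κ → ℝ}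
    (hθ : θ ∈ Icc lo hi) : (-quadFamily M₀ M₁ M₂ θ).PosDef := by
  classical
  refine PosDef.of_dotProduct_mulVec_pos (isHermitian_quadFamily M₀ M₁ M₂ h₀ h₁ h₂ θ).neg
    fun y hy => ?_
  have hM' : ∀ i, ∀ y : n → ℝ, 0 ≤ y ⬝ᵥ (M₂ i i *ᵥ y) := fun i y => by
    simpa using (hM i).dotProduct_mulVec_nonneg y
  have hvert' : ∀ v, IsVertex lo hi v → ∀ y : n → ℝ, y ≠ 0 →
      y ⬝ᵥ (quadFamily M₀ M₁ M₂ v *ᵥ y) < 0 :=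
    fun v hv y hy => by
      have h := (hvert v hv).dotProduct_mulVec_pos hy
      simp only [star_trivial, neg_mulVec, dotProduct_neg] at h
      linarith
  have h := form_neg_on_box_of_forall_vertex M₀ M₁ M₂ hM' hvert' hθ hy
  simpa [neg_mulVec, dotProduct_neg] using h

/-- `θᵀ diag(d) θ = Σᵢ dᵢ θᵢ²`. [folklore] -/
private theorem dotProduct_diagonal_mulVec [DecidableEq κ] (d θ : κ → ℝ) :
    θ ⬝ᵥ (diagonal d *ᵥ θ) = ∑ i, d i * θ i ^ 2 := by
  simp [mulVec_diagonal, dotProduct, pow_two, mul_left_comm]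

/-- **The relaxed vertex test (15)–(16)**: with multipliers `λᵢ ≥ 0`, if `Mᵢᵢ ≥ −λᵢ I` (16) and
`L(v) < −(Σᵢ λᵢvᵢ²) I` at every vertex `v` (15) — both as forms — then `L(θ) < 0` on the box: the
function `yᵀL(θ)y + (Σᵢ λᵢθᵢ²)‖y‖²` is multi-convex and negative at the vertices, and it dominates
`yᵀL(θ)y`. The sign `λᵢ ≥ 0` is the paper's *"any non-positive matrix-valued function of `θ` is a
good candidate for the right-hand side of (15)"*. [cite: ApkarianTuan2000, §4.1 (15)–(16)] -/
theorem form_neg_on_box_of_forall_vertex_relaxed (lam : κ → ℝ) (hlam : ∀ i, 0 ≤ lam i)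
    (h16 : ∀ i, ∀ y : n → ℝ, -(lam i) * (y ⬝ᵥ y) ≤ y ⬝ᵥ (M₂ i i *ᵥ y)) {lo hi : κ → ℝ}
    (h15 : ∀ v, IsVertex lo hi v → ∀ y : n → ℝ, y ≠ 0 →
      y ⬝ᵥ (quadFamily M₀ M₁ M₂ v *ᵥ y) < -(∑ i, lam i * v i ^ 2) * (y ⬝ᵥ y))
    {θ : κ → ℝ} (hθ : θ ∈ Icc lo hi) {y : n → ℝ} (hy : y ≠ 0) :
    y ⬝ᵥ (quadFamily M₀ M₁ M₂ θ *ᵥ y) < 0 := by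
  classical
  -- the augmented quadratic function of `θ`: `Q = (yᵀMᵢⱼy)ᵢⱼ + diag(λᵢ‖y‖²)`
  obtain ⟨Q, hQ⟩ : ∃ Q : Matrix κ κ ℝ,
      Q = Matrix.of (fun i j => y ⬝ᵥ (M₂ i j *ᵥ y)) + diagonal fun i => lam i * (y ⬝ᵥ y) :=
    ⟨_, rfl⟩
  have hg : ∀ θ : κ → ℝ,
      θ ⬝ᵥ (Q *ᵥ θ) + (fun i => y ⬝ᵥ (M₁ i *ᵥ y)) ⬝ᵥ θ + y ⬝ᵥ (M₀ *ᵥ y)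
        = y ⬝ᵥ (quadFamily M₀ M₁ M₂ θ *ᵥ y) + (∑ i, lam i * θ i ^ 2) * (y ⬝ᵥ y) := by
    intro θ
    rw [form_quadFamily, hQ, add_mulVec, dotProduct_add, dotProduct_diagonal_mulVec]
    have : ∑ i, lam i * (y ⬝ᵥ y) * θ i ^ 2 = (∑ i, lam i * θ i ^ 2) * (y ⬝ᵥ y) := by
      rw [Finset.sum_mul]; exact Finset.sum_congr rfl fun i _ => by ring
    rw [this]; ring
  have hQii : ∀ i, 0 ≤ Q i i := fun i => by
    have h := h16 i y
    rw [hQ, Matrix.add_apply, Matrix.of_apply, diagonal_apply_eq]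
    linarith
  have hvert : ∀ v, IsVertex lo hi v →
      v ⬝ᵥ (Q *ᵥ v) + (fun i => y ⬝ᵥ (M₁ i *ᵥ y)) ⬝ᵥ v + y ⬝ᵥ (M₀ *ᵥ y) < 0 := fun v hv => by
    rw [hg]; have h := h15 v hv y hy; linarith
  have hlt := (multiconvexOn_quadratic Q (fun i => y ⬝ᵥ (M₁ i *ᵥ y)) (y ⬝ᵥ (M₀ *ᵥ y)) hQii lo
    hi).lt_of_forall_vertex hvert hθ
  rw [hg] at hlt
  have hsq : 0 ≤ (∑ i, lam i * θ i ^ 2) * (y ⬝ᵥ y) :=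
    mul_nonneg (Finset.sum_nonneg fun i _ => mul_nonneg (hlam i) (sq_nonneg _))
      (by simpa using dotProduct_self_star_nonneg y)
  linarith

end PLMI

end Literature.Analysis.Convex.MulticonvexVertexPrinciple
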